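import Mathlib
import Summits.Langlands.Langlands.Theorems.SoloBlindCliffordIndexTwo

/-!
# Congruence rigidity of the sign function (solo-Langlands-blind, s9)

Kernel anchor for §5.12.3 of HOME/paper/dihedral-descent.md (attempt A32, "mod-ℓ propagation of
the sign function"). Setting of the door: `G = G_K ⊃ H = G_{K̃}` of index two; `ρ` is (the
reduction of) one of the two extensions of `ρ̃` to `G_K`, whose trace at an element `g ∉ H`
(Frobenius at the degree-one place over a reflection prime) is `e g · a g` with an unknown sign
`e g ∈ {±1}` and `a g` the Hecke trace; `ρ'` is the Galois representation of an ANCHORED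
congruent partner (base change, CM, Eisenstein), whose trace is `a g` on the nose. The two
representations agree on `H` (Brauer–Nesbitt + Chebotarev, not formalised here).

* `sign_rigid_of_clifford`: if `ρ|_H` has scalar commutant (absolutely irreducible anchor), the
  sign function `e` is CONSTANT (`= 1` or `= -1`) on `{g ∉ H : a g ≠ 0}` — from
  `clifford_index_two_dichotomy` (E17).
* `sign_rigid_of_characters`: the reducible (Eisenstein) anchor `ρ'^{ss} = φ₁ ⊕ φ₂`,
  `ρ^{ss} = ψ₁ ⊕ ψ₂` with `ψᵢ|_H = φᵢ|_H`: again `e` is constant on `{g ∉ H : φ₁ g + φ₂ g ≠ 0}`,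
  provided `2 ≠ 0`; the mixed case `ψ₁ = φ₁, ψ₂ = φ₂ ⊗ sgn_H` is excluded by `signs_eq_of_units`.

Pure algebra over a commutative ring without zero divisors.
-/

namespace Summit.Langlands.Langlands.Theorems.SoloBlind

open Matrix

variable {G : Type*} [Group G] {n : Type*} [Fintype n] [DecidableEq n] {R : Type*} [CommRing R]

/-- **Sign rigidity, absolutely irreducible anchor.** If `ρ, ρ' : G → GL_n(R)` agree on an
index-two subgroup `H` on which `ρ` has scalar commutant, `tr ρ' = a` everywhere and
`tr ρ g = e g * a g` off `H`, then there is ONE sign `s ∈ {1, -1}` with `e g = s` for every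
`g ∉ H` with `a g ≠ 0`. -/
theorem sign_rigid_of_clifford [Nonempty n] [NoZeroDivisors R] (H : Subgroup G)
    (hidx : H.index = 2) (ρ ρ' : G →* Matrix.GeneralLinearGroup n R)
    (hagree : ∀ h ∈ H, ρ h = ρ' h)
    (hSchur : ∀ M : Matrix.GeneralLinearGroup n R, (∀ h ∈ H, M * ρ h = ρ h * M) →
      ∃ c : Rˣ, (M : Matrix n n R) = (c : R) • (1 : Matrix n n R))
    (a e : G → R) (ha : ∀ g, Matrix.trace (ρ' g : Matrix n n R) = a g)
    (he : ∀ g, g ∉ H → Matrix.trace (ρ g : Matrix n n R) = e g * a g) :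
    ∃ s : R, (s = 1 ∨ s = -1) ∧ ∀ g, g ∉ H → a g ≠ 0 → e g = s := by
  rcases clifford_index_two_dichotomy H hidx ρ ρ' hagree hSchur with hall | hneg
  · refine ⟨1, Or.inl rfl, fun g hg hag => ?_⟩
    apply mul_right_cancel₀ hag
    rw [← he g hg, hall g, ha g, one_mul]
  · refine ⟨-1, Or.inr rfl, fun g hg hag => ?_⟩
    apply mul_right_cancel₀ hag
    rw [← he g hg, hneg g hg, Matrix.trace_neg, ha g, neg_one_mul]

/-- The sign function is then literally constant on the locus `a ≠ 0` off `H`. -/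
theorem sign_constant_of_clifford [Nonempty n] [NoZeroDivisors R] (H : Subgroup G)
    (hidx : H.index = 2) (ρ ρ' : G →* Matrix.GeneralLinearGroup n R)
    (hagree : ∀ h ∈ H, ρ h = ρ' h)
    (hSchur : ∀ M : Matrix.GeneralLinearGroup n R, (∀ h ∈ H, M * ρ h = ρ h * M) →
      ∃ c : Rˣ, (M : Matrix n n R) = (c : R) • (1 : Matrix n n R))
    (a e : G → R) (ha : ∀ g, Matrix.trace (ρ' g : Matrix n n R) = a g)
    (he : ∀ g, g ∉ H → Matrix.trace (ρ g : Matrix n n R) = e g * a g) :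
    ∀ g g', g ∉ H → g' ∉ H → a g ≠ 0 → a g' ≠ 0 → e g = e g' := by
  obtain ⟨s, -, hs⟩ := sign_rigid_of_clifford H hidx ρ ρ' hagree hSchur a e ha he
  intro g g' hg hg' hag hag'
  rw [hs g hg hag, hs g' hg' hag']

/-- Sign bookkeeping for the reducible anchor: if `s₁ u₁ + s₂ u₂ = e (u₁ + u₂)` with three signs
`s₁, s₂, e ∈ {1, -1}` and `u₁, u₂` non-zero, then `s₁ = s₂` (when `2 ≠ 0`, no zero divisors). -/
theorem signs_eq_of_units [NoZeroDivisors R] (htwo : (2 : R) ≠ 0) {s₁ s₂ e u₁ u₂ : R}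
    (hs₁ : s₁ = 1 ∨ s₁ = -1) (hs₂ : s₂ = 1 ∨ s₂ = -1) (he : e = 1 ∨ e = -1)
    (hu₁ : u₁ ≠ 0) (hu₂ : u₂ ≠ 0) (h : s₁ * u₁ + s₂ * u₂ = e * (u₁ + u₂)) : s₁ = s₂ := by
  rcases hs₁ with rfl | rfl <;> rcases hs₂ with rfl | rfl
  · rfl
  · exfalso
    rcases he with rfl | rfl
    · have h2 : (2 : R) * u₂ = 0 := by linear_combination -h
      exact hu₂ ((mul_eq_zero.mp h2).resolve_left htwo)
    · have h2 : (2 : R) * u₁ = 0 := by linear_combination h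
      exact hu₁ ((mul_eq_zero.mp h2).resolve_left htwo)
  · exfalso
    rcases he with rfl | rfl
    · have h2 : (2 : R) * u₁ = 0 := by linear_combination -h
      exact hu₁ ((mul_eq_zero.mp h2).resolve_left htwo)
    · have h2 : (2 : R) * u₂ = 0 := by linear_combination h
      exact hu₂ ((mul_eq_zero.mp h2).resolve_left htwo)
  · rfl

/-- **Sign rigidity, reducible (Eisenstein) anchor.** `H` of index two; characters
`φ₁ φ₂ ψ₁ ψ₂ : G → Rˣ` with `ψᵢ = φᵢ` on `H`; a sign function `e` off `H` with
`ψ₁ g + ψ₂ g = e g * (φ₁ g + φ₂ g)` for `g ∉ H`. Then (if `2 ≠ 0`) there is ONE sign `s` with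
`e g = s` whenever `g ∉ H` and `φ₁ g + φ₂ g ≠ 0`. Proof: `ψᵢ = cᵢ φᵢ` with `cᵢ ∈ {1, sgn_H}`
(`character_trivial_on_index_two`), and `c₁ ≠ c₂` is impossible (`signs_eq_of_units`). -/
theorem sign_rigid_of_characters [NoZeroDivisors R] (htwo : (2 : R) ≠ 0) (H : Subgroup G)
    (hidx : H.index = 2) (φ₁ φ₂ ψ₁ ψ₂ : G →* Rˣ) (h₁ : ∀ h ∈ H, ψ₁ h = φ₁ h)
    (h₂ : ∀ h ∈ H, ψ₂ h = φ₂ h) (e : G → R) (hepm : ∀ g, g ∉ H → (e g = 1 ∨ e g = -1))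
    (he : ∀ g, g ∉ H → (ψ₁ g : R) + ψ₂ g = e g * ((φ₁ g : R) + φ₂ g)) :
    ∃ s : R, (s = 1 ∨ s = -1) ∧ ∀ g, g ∉ H → (φ₁ g : R) + φ₂ g ≠ 0 → e g = s := by
  have hR : Nontrivial R := ⟨⟨2, 0, htwo⟩⟩
  -- an element off `H`
  obtain ⟨g₀, hg₀⟩ : ∃ g₀, g₀ ∉ H := by
    by_contra hcon
    push Not at hcon
    have htop : H = ⊤ := by
      ext x
      exact ⟨fun _ => trivial, fun _ => hcon x⟩
    rw [htop, Subgroup.index_top] at hidx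
    exact absurd hidx (by norm_num)
  -- the quotient characters are trivial on `H`, hence `±1`-valued and constant off `H`
  have hc₁ : ∀ h ∈ H, (ψ₁ / φ₁) h = 1 := fun h hh => by
    rw [MonoidHom.div_apply, h₁ h hh, div_self']
  have hc₂ : ∀ h ∈ H, (ψ₂ / φ₂) h = 1 := fun h hh => by
    rw [MonoidHom.div_apply, h₂ h hh, div_self']
  obtain ⟨hpm₁, hconst₁⟩ := character_trivial_on_index_two H hidx (ψ₁ / φ₁) hc₁
  obtain ⟨hpm₂, hconst₂⟩ := character_trivial_on_index_two H hidx (ψ₂ / φ₂) hc₂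
  set s₁ : R := ((ψ₁ / φ₁) g₀ : R) with hs₁def
  set s₂ : R := ((ψ₂ / φ₂) g₀ : R) with hs₂def
  -- off `H`: `ψᵢ g = sᵢ φᵢ g`
  have hψ₁ : ∀ g, g ∉ H → (ψ₁ g : R) = s₁ * φ₁ g := by
    intro g hg
    rw [hs₁def, ← hconst₁ g g₀ hg hg₀, MonoidHom.div_apply, ← Units.val_mul, div_mul_cancel]
  have hψ₂ : ∀ g, g ∉ H → (ψ₂ g : R) = s₂ * φ₂ g := by
    intro g hg
    rw [hs₂def, ← hconst₂ g g₀ hg hg₀, MonoidHom.div_apply, ← Units.val_mul, div_mul_cancel]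
  -- the two constants agree (tested at `g₀`)
  have hseq : s₁ = s₂ := by
    have h0 := he g₀ hg₀
    rw [hψ₁ g₀ hg₀, hψ₂ g₀ hg₀] at h0
    exact signs_eq_of_units htwo (hpm₁ g₀) (hpm₂ g₀) (hepm g₀ hg₀) (Units.ne_zero _)
      (Units.ne_zero _) h0
  refine ⟨s₁, hpm₁ g₀, fun g hg hsum => ?_⟩
  have h0 := he g hg
  rw [hψ₁ g hg, hψ₂ g hg, ← hseq, ← mul_add] at h0
  exact (mul_right_cancel₀ hsum h0).symm

end Summit.Langlands.Langlands.Theorems.SoloBlind
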